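import Mathlib
import Literature.NumberTheory.Sieve.Maynard2016TupleArith
import HarnessLib

/-!
# Maynard 2016: support of the sieve weights `λ_{d,e}` and the constraints `d_k = e_k = 1`

Topic `Literature/NumberTheory/Sieve`. J. Maynard, *Large gaps between primes*, Ann. of Math. (2)
183 (2016), 915–933 = arXiv:1408.5110, §5 displays (5.3)–(5.4) (the weights
`λ_{d,e} = (∏ μ(d_i)μ(e_i)) Σ_j c_j ∏_ℓ F_{ℓ,j}(log d_ℓ/log x) G(log e_ℓ/log y)` with
`sup{Σ u_ℓ : F_{ℓ,j}(u_ℓ) ≠ 0 ∀ℓ} ≤ 1/10` and `G` supported on `[0,1]`) and §6, proof of Lemma 7,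
display (6.26): "we may also restrict to `e_k = 1`, since `(mp₀ − 1, P_y) = 1`" and "in our
lower bound … `d_k = 1`" (here the distinguished index is `i`, the source having taken `h = h_k`).

PROVED here (no named facts): `lam_eq_zero_of_rpow_lt` (`λ_{d,e} = 0` if some `d_i > x^{1/10}`),
`lam_eq_zero_of_y_lt` (`λ_{d,e} = 0` if some `e_i > y`), `lam_eq_zero_of_dvd_prime` (a divisor
`d_i ≠ 1` of a prime `p₀ > x^{1/10}` kills `λ`), `eq_one_of_dvd_of_coprime_primorial` (a divisor
`e ≤ Y` of an integer coprime to `∏_{p ≤ Y} p` is `1`), `apply_eq_one_of_lam_ne_zero` (`e_i = 1`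
at `n = p₀ − h_i q`), the restriction identity `divSum_sub_hTuple_mul_eq` (at `n = p₀ − h_i q` the
divisor sum of (4.1) may be restricted to `d_i = e_i = 1`), and `eventually_rpow_tenth_lt_z`
(`x^{1/10} < z` for large `x`, so every `p₀ ∈ 𝓡_m` exceeds `x^{1/10}`).

## References

* J. Maynard, *Large gaps between primes*, Ann. of Math. (2) 183 (2016), 915–933; arXiv:1408.5110,
  §5 (5.3)–(5.4) and Lemma 7 (proof, display (6.26)). [Maynard2016LargeGaps]
-/

open Filter Finset
open scoped Topology

namespace Literature.NumberTheory.Sieve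

namespace Maynard2016

/-! ### Support of `λ` -/

/-- `λ_{d,e} = 0` as soon as some `d_i > x^{1/10}` (all `d_ℓ ≥ 1`): by (5.4) some factor
`F_{ℓ,j}(log d_ℓ/log x)` vanishes for every `j`. [cite: Maynard2016LargeGaps, §5 display (5.4)] -/
theorem lam_eq_zero_of_rpow_lt {k J : ℕ} {c : Fin J → ℝ} {Fd : Fin k → Fin J → ℝ → ℝ} {G : ℝ → ℝ}
    (hD : IsSieveData k J c Fd G) {ε : ℝ} {x : ℕ} (hlogx : 0 < Real.log x) {d e : Fin k → ℕ}
    (hd : ∀ ℓ, 1 ≤ d ℓ) {i : Fin k} (hi : (x : ℝ) ^ (1 / 10 : ℝ) < d i) :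
    lam c Fd G ε x d e = 0 := by
  unfold lam
  apply mul_eq_zero_of_right
  apply Finset.sum_eq_zero
  intro j _
  apply mul_eq_zero_of_right
  by_contra hne
  have hall : ∀ ℓ, Fd ℓ j (Real.log (d ℓ) / Real.log x) ≠ 0 := by
    intro ℓ hzero
    exact hne (Finset.prod_eq_zero (Finset.mem_univ ℓ) (by rw [hzero, zero_mul]))
  have hu0 : ∀ ℓ, 0 ≤ Real.log (d ℓ) / Real.log x := fun ℓ =>
    div_nonneg (Real.log_nonneg (by exact_mod_cast hd ℓ)) hlogx.le
  have hsum := hD.Fd_support j (fun ℓ => Real.log (d ℓ) / Real.log x) hu0 hall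
  have hx0 : (0 : ℝ) < x := by
    have hx1 : (x : ℝ) ≠ 0 := by
      intro h0; rw [h0, Real.log_zero] at hlogx; exact lt_irrefl _ hlogx
    exact lt_of_le_of_ne (Nat.cast_nonneg _) (Ne.symm hx1)
  have hui : 1 / 10 < Real.log (d i) / Real.log x := by
    rw [lt_div_iff₀ hlogx]
    have h1 : Real.log ((x : ℝ) ^ (1 / 10 : ℝ)) < Real.log (d i) :=
      Real.log_lt_log (Real.rpow_pos_of_pos hx0 _) hi
    rwa [Real.log_rpow hx0] at h1
  have hle : Real.log (d i) / Real.log x ≤ ∑ ℓ, Real.log (d ℓ) / Real.log x :=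
    Finset.single_le_sum (fun ℓ _ => hu0 ℓ) (Finset.mem_univ i)
  have : ∑ ℓ, Real.log (d ℓ) / Real.log x ≤ 1 / 10 := hsum
  linarith

/-- `λ_{d,e} = 0` as soon as some `e_i > y` (`G` is supported on `[0,1]`). [cite: Maynard2016LargeGaps, §5 display (5.3)] -/
theorem lam_eq_zero_of_y_lt {k J : ℕ} {c : Fin J → ℝ} {Fd : Fin k → Fin J → ℝ → ℝ} {G : ℝ → ℝ}
    (hD : IsSieveData k J c Fd G) {ε : ℝ} {x : ℕ} (hlogy : 0 < Real.log (y ε x))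
    {d e : Fin k → ℕ} {i : Fin k} (hi : y ε x < e i) : lam c Fd G ε x d e = 0 := by
  unfold lam
  apply mul_eq_zero_of_right
  apply Finset.sum_eq_zero
  intro j _
  apply mul_eq_zero_of_right
  apply Finset.prod_eq_zero (Finset.mem_univ i)
  have hy0 : 0 < y ε x := by unfold y; exact Real.exp_pos _
  have h1 : 1 < Real.log (e i) / Real.log (y ε x) := by
    rw [one_lt_div hlogy]
    exact Real.log_lt_log hy0 hi
  rw [hD.G_support _ h1, mul_zero]

/-- A divisor `d_i ≠ 1` of a prime `p₀ > x^{1/10}` kills `λ_{d,e}` ("`d_k = 1`" in (6.26)).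
[cite: Maynard2016LargeGaps, Lemma 7 (proof, display (6.26))] -/
theorem lam_eq_zero_of_dvd_prime {k J : ℕ} {c : Fin J → ℝ} {Fd : Fin k → Fin J → ℝ → ℝ}
    {G : ℝ → ℝ} (hD : IsSieveData k J c Fd G) {ε : ℝ} {x : ℕ} (hlogx : 0 < Real.log x) {p₀ : ℕ}
    (hp₀ : p₀.Prime) (hx10 : (x : ℝ) ^ (1 / 10 : ℝ) < p₀) {d e : Fin k → ℕ} (hd : ∀ ℓ, 1 ≤ d ℓ)
    {i : Fin k} (hdi : d i ∣ p₀) (hne : d i ≠ 1) : lam c Fd G ε x d e = 0 := by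
  have h1 : d i = p₀ := (hp₀.eq_one_or_self_of_dvd _ hdi).resolve_left hne
  exact lam_eq_zero_of_rpow_lt hD hlogx hd (i := i) (by rw [h1]; exact hx10)

/-- A divisor `e ≤ Y` of an integer `N ≠ 0` coprime to `∏_{p ≤ Y} p` equals `1`.
[cite: Maynard2016LargeGaps, Lemma 7 (proof, display (6.26), «since (mp₀ − 1, P_y) = 1»)] -/
theorem eq_one_of_dvd_of_coprime_primorial {e N : ℕ} {Y : ℝ} (he : e ∣ N) (hN0 : N ≠ 0)
    (hN : Nat.Coprime N (primorial ⌊Y⌋₊)) (heY : (e : ℝ) ≤ Y) : e = 1 := by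
  by_contra hne
  obtain ⟨p, hp, hpe⟩ := Nat.exists_prime_and_dvd hne
  have he0 : e ≠ 0 := ne_zero_of_dvd_ne_zero hN0 he
  have hpY : p ∣ primorial ⌊Y⌋₊ := by
    rw [hp.dvd_primorial_iff]
    have h1 : p ≤ e := Nat.le_of_dvd (Nat.pos_of_ne_zero he0) hpe
    have h2 : (p : ℝ) ≤ Y := le_trans (by exact_mod_cast h1) heY
    exact Nat.le_floor h2
  have h3 : p ∣ Nat.gcd N (primorial ⌊Y⌋₊) := Nat.dvd_gcd (hpe.trans he) hpY
  rw [hN] at h3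
  exact hp.one_lt.ne' (Nat.dvd_one.1 h3)

/-- At a term with `λ_{d,e} ≠ 0`, a divisor `e_i` of `m p₀ − 1` (with `(m p₀ − 1, P_y) = 1`) is `1`
("`e_k = 1`" in (6.26)). [cite: Maynard2016LargeGaps, Lemma 7 (proof, display (6.26))] -/
theorem apply_eq_one_of_lam_ne_zero {k J : ℕ} {c : Fin J → ℝ} {Fd : Fin k → Fin J → ℝ → ℝ}
    {G : ℝ → ℝ} (hD : IsSieveData k J c Fd G) {ε : ℝ} {x : ℕ} (hlogy : 0 < Real.log (y ε x))
    {N : ℕ} (hN0 : N ≠ 0) (hN : Nat.Coprime N (primorial ⌊y ε x⌋₊)) {d e : Fin k → ℕ}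
    {i : Fin k} (he : e i ∣ N) (hlam : lam c Fd G ε x d e ≠ 0) : e i = 1 :=
  eq_one_of_dvd_of_coprime_primorial he hN0 hN
    (le_of_not_gt fun h => hlam (lam_eq_zero_of_y_lt hD hlogy h))

/-! ### The restriction `d_i = e_i = 1` at `n = p₀ − h_i q` -/

/-- **Display (6.26), the constraints `d_i = e_i = 1`:** at `n = p₀ − h_i q` (with `p₀` a prime
`> x^{1/10}`, `(m p₀ − 1, P_y) = 1`, `m ≥ 1`) the divisor sum of (4.1) is unchanged by restricting
to `d_i = 1` and `e_i = 1`. [cite: Maynard2016LargeGaps, Lemma 7 (proof, display (6.26))] -/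
theorem divSum_sub_hTuple_mul_eq {k J : ℕ} {c : Fin J → ℝ} {Fd : Fin k → Fin J → ℝ → ℝ}
    {G : ℝ → ℝ} (hD : IsSieveData k J c Fd G) {ε : ℝ} {x : ℕ} (hlogx : 0 < Real.log x)
    (hlogy : 0 < Real.log (y ε x)) {m q p₀ : ℕ} (hm : 1 ≤ m) (hp₀ : p₀.Prime)
    (hx10 : (x : ℝ) ^ (1 / 10 : ℝ) < p₀) (hcop : Nat.Coprime (m * p₀ - 1) (primorial ⌊y ε x⌋₊))
    {i : Fin k} (hle : hTuple k x i * q ≤ p₀) :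
    divSum c Fd G ε x m q (p₀ - hTuple k x i * q) =
      ∑ d ∈ (Fintype.piFinset fun ℓ : Fin k =>
          (p₀ - hTuple k x i * q + hTuple k x ℓ * q).divisors).filter (fun d => d i = 1),
        ∑ e ∈ (Fintype.piFinset fun ℓ : Fin k =>
            (m * (p₀ - hTuple k x i * q + hTuple k x ℓ * q) - 1).divisors).filter (fun e => e i = 1),
          lam c Fd G ε x d e := by
  have hn : p₀ - hTuple k x i * q + hTuple k x i * q = p₀ := Nat.sub_add_cancel hle
  have hN0 : m * p₀ - 1 ≠ 0 := by
    have : 2 ≤ m * p₀ := le_trans hp₀.two_le (Nat.le_mul_of_pos_left _ (by omega))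
    omega
  unfold divSum
  symm
  rw [Finset.sum_filter_of_ne]
  · refine Finset.sum_congr rfl fun d _ => Finset.sum_filter_of_ne fun e he hne => ?_
    have hei : e i ∣ m * p₀ - 1 := by
      have := (Nat.mem_divisors.1 (Fintype.mem_piFinset.1 he i)).1
      rwa [hn] at this
    exact apply_eq_one_of_lam_ne_zero hD hlogy hN0 hcop hei hne
  · intro d hd hne
    by_contra hdi
    apply hne
    refine Finset.sum_eq_zero fun e _ => ?_
    have hd1 : ∀ ℓ, 1 ≤ d ℓ := fun ℓ =>
      Nat.pos_of_mem_divisors (Fintype.mem_piFinset.1 hd ℓ)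
    have hdi' : d i ∣ p₀ := by
      have := (Nat.mem_divisors.1 (Fintype.mem_piFinset.1 hd i)).1
      rwa [hn] at this
    exact lam_eq_zero_of_dvd_prime hD hlogx hp₀ hx10 hd1 hdi' hdi

/-! ### `x^{1/10} < z` -/

/-- `x^{1/10} < z = x/log₂ x` for all large `x` (so every `p₀ ∈ 𝓡_m`, being `> z`, exceeds
`x^{1/10} ≥ ∏ d_ℓ`). [cite: Maynard2016LargeGaps, §2 display (2.1)] -/
theorem eventually_rpow_tenth_lt_z : ∀ᶠ x : ℕ in atTop, (x : ℝ) ^ (1 / 10 : ℝ) < z x := by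
  have hlo := (isLittleO_log_rpow_atTop (show (0 : ℝ) < 9 / 10 by norm_num)).bound
    (show (0 : ℝ) < 1 / 2 by norm_num)
  have hreal : ∀ᶠ X : ℝ in atTop, X ^ (1 / 10 : ℝ) < X / Real.log (Real.log X) := by
    filter_upwards [hlo, (Real.tendsto_log_atTop.comp Real.tendsto_log_atTop).eventually_gt_atTop 0,
      Real.tendsto_log_atTop.eventually_gt_atTop 0, eventually_gt_atTop (0 : ℝ)]
      with X hX hL₂ hL hX0
    have hL₂' : Real.log (Real.log X) ≤ Real.log X := by
      have := Real.log_le_sub_one_of_pos hL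
      simp only [Function.comp] at hL₂ ⊢
      linarith
    have hr0 : 0 < X ^ (9 / 10 : ℝ) := Real.rpow_pos_of_pos hX0 _
    rw [Real.norm_eq_abs, Real.norm_eq_abs, abs_of_pos hL, abs_of_pos hr0] at hX
    have h1 : Real.log (Real.log X) < X ^ (9 / 10 : ℝ) := by
      simp only [Function.comp] at hL₂ ⊢; linarith
    have hL₂0 : 0 < Real.log (Real.log X) := by simpa [Function.comp] using hL₂
    rw [lt_div_iff₀ hL₂0]
    have h2 : X ^ (1 / 10 : ℝ) * X ^ (9 / 10 : ℝ) = X := by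
      rw [← Real.rpow_add hX0]; norm_num
    calc X ^ (1 / 10 : ℝ) * Real.log (Real.log X)
        < X ^ (1 / 10 : ℝ) * X ^ (9 / 10 : ℝ) :=
          mul_lt_mul_of_pos_left h1 (Real.rpow_pos_of_pos hX0 _)
      _ = X := h2
  have := tendsto_natCast_atTop_atTop.eventually hreal
  unfold z
  exact this

/-- Every `p₀ ∈ 𝓡_m` exceeds `x^{1/10}` once `x^{1/10} < z`. [cite: Maynard2016LargeGaps, Lemma 7 (proof, display (6.26))] -/
theorem rpow_tenth_lt_of_mem_Rm {C_U ε : ℝ} {x m p₀ : ℕ} (hz : (x : ℝ) ^ (1 / 10 : ℝ) < z x)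
    (hp₀ : p₀ ∈ Rm C_U ε x m) : (x : ℝ) ^ (1 / 10 : ℝ) < p₀ := by
  simp only [Rm, sievedPrimes, Finset.mem_filter, Finset.mem_Icc] at hp₀
  exact hz.trans hp₀.2.2.1

/-- For `p₀ ∈ 𝓡_m`: `p₀` is prime and `(m p₀ − 1, P_y) = 1` (unpacking the definition of `𝓡_m`).
[cite: Maynard2016LargeGaps, §2 (definition of 𝓡_m)] -/
theorem prime_and_coprime_of_mem_Rm {C_U ε : ℝ} {x m p₀ : ℕ} (hp₀ : p₀ ∈ Rm C_U ε x m) :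
    p₀.Prime ∧ z x < p₀ ∧ Nat.Coprime (m * p₀ - 1) (primorial ⌊y ε x⌋₊) ∧
      p₀ ≤ ⌊U C_U ε x / m⌋₊ := by
  simp only [Rm, sievedPrimes, Finset.mem_filter, Finset.mem_Icc] at hp₀
  exact ⟨hp₀.2.1, hp₀.2.2.1, hp₀.2.2.2, hp₀.1.2⟩

end Maynard2016

end Literature.NumberTheory.Sieve
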